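import Literature.Computability.Complexity.KnapsackSosLowerBound
import HarnessLib

/-!
# Grigoriev's knapsack bound is tight: a Positivstellensatz refutation of degree `2k + 4`
# (Lee–Prakash–de Wolf–Yuen 2016, Theorem 4.3 and Lemma 4.4)

Source: T. Lee, A. Prakash, R. de Wolf, H. Yuen, *On the sum-of-squares degree of symmetric quadratic
functions*, CCC 2016 (LIPIcs 50), arXiv:1601.02311, §4.1 [LeePrakashDewolfYuen2016] (held text
`paper:arxiv-1601.02311`, chunk 14):

> **Theorem 4.3.** Let `0 ≤ k ≤ n/2` be an integer. For `k < r < k+1`, the system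
> `f = Σ_i x_i − r = 0, x_j² − x_j = 0` has a Positivstellensatz refutation of degree `2k+4`.
>
> **Lemma 4.4.** There exist polynomials `g_i(x)` of degree at most `2k−2` such that
> `A_k(x) = Σ_i (x_i² − x_i) g_i(x) + (k!) e_k(x_1², …, x_n²)`, where
> `A_k(x) = |x|(|x|−1)(|x|−2)⋯(|x|−k+1)`, `|x| = Σ_i x_i`.
>
> *Proof of Theorem 4.3.* "Let `b = −r(r−1)⋯(r−k)(r−k−1) > 0`. Then `|x| − r` divides `A_{k+2}(x) + b`
> and we can write `A_{k+2}(x) + b = g(x)(|x| − r)` for some polynomial `g` of degree `2k+3`."  Hence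
> `g(x)(|x| − r) − b = A_{k+2}(x) = (k+2)!·e_{k+2}(x_1²,…,x_n²) + Σ_i (x_i² − x_i) g_i`, and dividing by
> `b`: `−1 = ((k+2)!/b)·Σ_{|I|=k+2} (x_I)² + Σ_i (x_i² − x_i) g_i/b − (g/b)(|x| − r)`.

This is the converse of Grigoriev 2001, Theorem (i) (`Knapsack.not_hasSOSRefutation_succ` in
`KnapsackSosLowerBound.lean`: no refutation of half-degree `k + 1`, i.e. degree `≤ 2k + 3`, when
`k < r < n − k`), answering the question Grigoriev left open ("It would be interesting to learn how
close are they to upper bounds", [Grigoriev2001] p. 6).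

## What is here (all proved; no named facts)

In the tree's static-SOS currency `HasSOSRefutation S d` (squares of total degree `≤ d`, products
`g_e · S e` of total degree `≤ 2d`, `Σ q_l² + Σ g_e S e = −1`; file `SumOfSquaresRefutation.lean`):

* `Knapsack.hasSOSRefutation_of_lt` — **Theorem 4.3**: for `k < r < k + 1` (any `n`; for `n < k + 2`
  there are no squares and the certificate degenerates to a Nullstellensatz refutation),
  `HasSOSRefutation (Knapsack.system n r) (k + 2)` (refutation degree `2k + 4`).  The certificate is the
  printed one: squares `√((k+2)!/b)·x_I` (`|I| = k+2`), the knapsack multiplier `−g(|x|)/b` with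
  `g = (A_{k+2} + b)/(X − r)` (univariate quotient, `Polynomial.divByMonic`), and Boolean multipliers
  of product degree `≤ 2k + 4` from the two congruences behind Lemma 4.4:
  `|x|·e_k ≡ (k+1) e_{k+1} + k e_k` and `x_I² ≡ x_I` modulo `(x_i² − x_i)` with degree control
  (`sum_X_mul_esym`, `prod_sub_eq_factorial_mul_esym`, `xProd_sq_sub_inBool`).
* `Knapsack.hasSOSRefutation_iff` — the EXACT THRESHOLD: for an integer `k` with `2k + 2 ≤ n` and
  `k < r < k + 1`, `HasSOSRefutation (Knapsack.system n r) d ↔ k + 2 ≤ d` (Grigoriev's lower bound +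
  Theorem 4.3 + monotonicity).
* `Knapsack.functional_xProd_neg` — the pseudo-expectation form of tightness asked for by the
  psd-rank cell (MEMO-20 §4 (L2)): Grigoriev's own functional `B` is NOT positive on squares of degree
  `k + 2`: for `|I| = k + 2`, `B(x_I²) = B(x_I) = r(r−1)⋯(r−k−1)/(n(n−1)⋯(n−k−1)) < 0` — the witness
  "as a formula" is the monomial `h = x_I`.

## What is NOT here
* Theorem 4.3 prints the hypothesis `0 ≤ k ≤ n/2`; the certificate needs none (proved for all `n`),
  while the matching LOWER bound (`not_hasSOSRefutation_succ`) needs `2k + 2 ≤ n` — hence the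
  hypothesis of `hasSOSRefutation_iff`.
* Positivstellensatz CALCULUS (dynamic) degrees (Grigoriev's Theorem (ii)): not treated.

## References
* [LeePrakashDewolfYuen2016] T. Lee, A. Prakash, R. de Wolf, H. Yuen, *On the sum-of-squares degree
  of symmetric quadratic functions*, CCC 2016, §4.1, Theorem 4.3, Lemma 4.4.
* [Grigoriev2001] D. Grigoriev, *Complexity of Positivstellensatz proofs for the knapsack*, comput.
  complexity 10 (2001) 139–154, Theorem (i), §1 (the functional `B`).
-/

noncomputable section

open MvPolynomial Finset

namespace Literature.Computability.Complexity

namespace Knapsack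

variable {n : ℕ}

/-! ### The Boolean ideal truncated by degree -/

/-- `InBool n D p`: `p = Σ_i h_i · (X_i² − X_i)` with every product of total degree `≤ D` (membership
in the degree-`D` truncation of the Boolean ideal). [folklore] -/
private def InBool (n D : ℕ) (p : MvPolynomial (Fin n) ℝ) : Prop :=
  ∃ h : Fin n → MvPolynomial (Fin n) ℝ,
    (∑ i, h i * (X i ^ 2 - X i)) = p ∧ ∀ i, (h i * (X i ^ 2 - X i)).totalDegree ≤ D

/-- `0` lies in every truncation. [folklore] -/
private theorem InBool.zero (D : ℕ) : InBool n D 0 :=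
  ⟨0, by simp, fun i => by simp⟩

/-- Truncated ideal membership is additive. [folklore] -/
private theorem InBool.add {D : ℕ} {p q : MvPolynomial (Fin n) ℝ} (hp : InBool n D p)
    (hq : InBool n D q) : InBool n D (p + q) := by
  obtain ⟨h, hh, hd⟩ := hp
  obtain ⟨h', hh', hd'⟩ := hq
  refine ⟨h + h', ?_, fun i => ?_⟩
  · rw [← hh, ← hh', ← Finset.sum_add_distrib]
    exact Finset.sum_congr rfl fun i _ => by simp only [Pi.add_apply, add_mul]
  · simp only [Pi.add_apply, add_mul]
    exact (totalDegree_add _ _).trans (max_le (hd i) (hd' i))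

/-- Monotonicity in the degree. [folklore] -/
private theorem InBool.mono {D D' : ℕ} (hDD : D ≤ D') {p : MvPolynomial (Fin n) ℝ}
    (hp : InBool n D p) : InBool n D' p := by
  obtain ⟨h, hh, hd⟩ := hp
  exact ⟨h, hh, fun i => (hd i).trans hDD⟩

/-- Finite sums. [folklore] -/
private theorem InBool.sum {D : ℕ} {α : Type*} (s : Finset α) (f : α → MvPolynomial (Fin n) ℝ)
    (h : ∀ a ∈ s, InBool n D (f a)) : InBool n D (∑ a ∈ s, f a) := by
  classical
  induction s using Finset.induction_on with
  | empty => simpa using InBool.zero D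
  | insert a s ha ih =>
    rw [Finset.sum_insert ha]
    exact (h a (Finset.mem_insert_self _ _)).add (ih fun b hb => h b (Finset.mem_insert_of_mem hb))

/-- Multiplication by a polynomial of degree `≤ a` raises the truncation by `a`. [folklore] -/
private theorem InBool.mul_left {D a : ℕ} (q : MvPolynomial (Fin n) ℝ) (hq : q.totalDegree ≤ a)
    {p : MvPolynomial (Fin n) ℝ} (hp : InBool n D p) : InBool n (a + D) (q * p) := by
  obtain ⟨h, hh, hd⟩ := hp
  refine ⟨fun i => q * h i, ?_, fun i => ?_⟩
  · rw [← hh, Finset.mul_sum]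
    exact Finset.sum_congr rfl fun i _ => by ring
  · rw [mul_assoc]
    exact (totalDegree_mul _ _).trans (add_le_add hq (hd i))

/-- Multiplication by a constant. [folklore] -/
private theorem InBool.const_mul {D : ℕ} (c : ℝ) {p : MvPolynomial (Fin n) ℝ} (hp : InBool n D p) :
    InBool n D (C c * p) := by
  have := hp.mul_left (a := 0) (C c) (by rw [totalDegree_C])
  simpa using this

/-- Subtraction. [folklore] -/
private theorem InBool.sub {D : ℕ} {p q : MvPolynomial (Fin n) ℝ} (hp : InBool n D p)
    (hq : InBool n D q) : InBool n D (p - q) := by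
  have h := hp.add (hq.const_mul (-1))
  simpa [sub_eq_add_neg] using h

/-- A single product `q · (X_i² − X_i)` of degree `≤ D`. [folklore] -/
private theorem inBool_single {D : ℕ} (i : Fin n) (q : MvPolynomial (Fin n) ℝ)
    (h : (q * (X i ^ 2 - X i)).totalDegree ≤ D) : InBool n D (q * (X i ^ 2 - X i)) := by
  classical
  refine ⟨Pi.single i q, ?_, fun j => ?_⟩
  · rw [Finset.sum_eq_single i (fun j _ hj => by rw [Pi.single_eq_of_ne hj, zero_mul])
      (fun h => absurd (Finset.mem_univ _) h), Pi.single_eq_same]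
  · by_cases hj : j = i
    · subst hj
      rw [Pi.single_eq_same]
      exact h
    · rw [Pi.single_eq_of_ne hj, zero_mul, totalDegree_zero]
      exact Nat.zero_le _

/-! ### Monomials, elementary symmetric polynomials, degrees -/

/-- The multilinear monomial `x_I = ∏_{i ∈ I} X_i`. [folklore] -/
private def xProd (I : Finset (Fin n)) : MvPolynomial (Fin n) ℝ := ∏ i ∈ I, X i

/-- The elementary symmetric polynomial `e_k = Σ_{|I| = k} x_I`. [folklore] -/
private def esym (n k : ℕ) : MvPolynomial (Fin n) ℝ := ∑ I ∈ powersetCard k (univ : Finset (Fin n)), xProd I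

/-- `deg x_I ≤ |I|`. [folklore] -/
private theorem totalDegree_xProd_le (I : Finset (Fin n)) : (xProd I).totalDegree ≤ I.card := by
  unfold xProd
  refine (totalDegree_finsetProd _ _).trans (le_of_eq ?_)
  calc ∑ i ∈ I, (X i : MvPolynomial (Fin n) ℝ).totalDegree = ∑ i ∈ I, 1 :=
        Finset.sum_congr rfl fun i _ => totalDegree_X i
    _ = I.card := by simp

/-- `deg (X_i² − X_i) ≤ 2`. [folklore] -/
private theorem totalDegree_bool_le (i : Fin n) :
    (X i ^ 2 - X i : MvPolynomial (Fin n) ℝ).totalDegree ≤ 2 := by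
  refine (totalDegree_sub _ _).trans (max_le ?_ ?_)
  · rw [totalDegree_X_pow]
  · rw [totalDegree_X]
    norm_num

/-- `deg (Σ_i X_i) ≤ 1`. [folklore] -/
private theorem totalDegree_sumX_le :
    (∑ i : Fin n, (X i : MvPolynomial (Fin n) ℝ)).totalDegree ≤ 1 :=
  totalDegree_finsetSum_le fun i _ => by rw [totalDegree_X]

/-- `x_I² − x_I` lies in the Boolean ideal with products of degree `≤ 2|I|` (the congruence
`e_k(x_1², …, x_n²) ≡ e_k(x)` behind Lemma 4.4). [cite: LeePrakashDewolfYuen2016, Lemma 4.4] -/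
private theorem xProd_sq_sub_inBool (I : Finset (Fin n)) :
    InBool n (2 * I.card) (xProd I * xProd I - xProd I) := by
  classical
  induction I using Finset.induction_on with
  | empty =>
    simp only [xProd, Finset.prod_empty, mul_one, sub_self, Finset.card_empty, mul_zero]
    exact InBool.zero 0
  | insert a I ha ih =>
    rw [Finset.card_insert_of_notMem ha]
    have hx : xProd (insert a I) = X a * xProd I := by
      unfold xProd
      rw [Finset.prod_insert ha]
    rw [hx]
    have hsplit : X a * xProd I * (X a * xProd I) - X a * xProd I
        = X a ^ 2 * (xProd I * xProd I - xProd I) + xProd I * (X a ^ 2 - X a) := by ring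
    rw [hsplit]
    refine InBool.add ?_ ?_
    · exact (ih.mul_left (X a ^ 2) (by rw [totalDegree_X_pow])).mono (by omega)
    · refine inBool_single a (xProd I) ?_
      have h1 := totalDegree_xProd_le I
      have h2 := totalDegree_bool_le (n := n) a
      exact (totalDegree_mul _ _).trans (by omega)

/-- Double counting: `Σ_{|I| = k} Σ_{i ∉ I} f(I ∪ {i}) = (k+1)·Σ_{|J| = k+1} f(J)`. [folklore] -/
private theorem sum_sum_insert {M : Type*} [AddCommMonoid M] (k : ℕ) (f : Finset (Fin n) → M) :
    ∑ I ∈ powersetCard k (univ : Finset (Fin n)), ∑ i ∈ Iᶜ, f (insert i I) =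
      (k + 1) • ∑ J ∈ powersetCard (k + 1) (univ : Finset (Fin n)), f J := by
  classical
  rw [Finset.smul_sum]
  have hJ : ∀ J ∈ powersetCard (k + 1) (univ : Finset (Fin n)),
      (k + 1) • f J = ∑ i ∈ J, f (insert i (J.erase i)) := by
    intro J hJ
    have hc : J.card = k + 1 := (Finset.mem_powersetCard.1 hJ).2
    have h' : ∀ i ∈ J, f (insert i (J.erase i)) = f J := fun i hi => by rw [Finset.insert_erase hi]
    rw [Finset.sum_congr rfl h', Finset.sum_const, hc]
  rw [Finset.sum_congr rfl hJ, Finset.sum_sigma', Finset.sum_sigma']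
  refine Finset.sum_bij' (fun x _ => ⟨insert x.2 x.1, x.2⟩) (fun y _ => ⟨y.1.erase y.2, y.2⟩)
    ?_ ?_ ?_ ?_ ?_
  · rintro ⟨I, i⟩ hx
    obtain ⟨hI, hi⟩ := Finset.mem_sigma.1 hx
    have hcI : I.card = k := (Finset.mem_powersetCard.1 hI).2
    have hi' : i ∉ I := Finset.mem_compl.1 hi
    refine Finset.mem_sigma.2 ⟨?_, Finset.mem_insert_self _ _⟩
    exact Finset.mem_powersetCard.2 ⟨Finset.subset_univ _, by rw [Finset.card_insert_of_notMem hi', hcI]⟩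
  · rintro ⟨J, i⟩ hy
    obtain ⟨hJ, hi⟩ := Finset.mem_sigma.1 hy
    have hcJ : J.card = k + 1 := (Finset.mem_powersetCard.1 hJ).2
    refine Finset.mem_sigma.2 ⟨?_, ?_⟩
    · exact Finset.mem_powersetCard.2 ⟨Finset.subset_univ _,
        by rw [Finset.card_erase_of_mem hi, hcJ, Nat.add_sub_cancel]⟩
    · exact Finset.mem_compl.2 (Finset.notMem_erase i J)
  · rintro ⟨I, i⟩ hx
    obtain ⟨-, hi⟩ := Finset.mem_sigma.1 hx
    have hi' : i ∉ I := Finset.mem_compl.1 hi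
    simp [Finset.erase_insert hi']
  · rintro ⟨J, i⟩ hy
    obtain ⟨-, hi⟩ := Finset.mem_sigma.1 hy
    simp [Finset.insert_erase hi]
  · rintro ⟨I, i⟩ hx
    obtain ⟨-, hi⟩ := Finset.mem_sigma.1 hx
    have hi' : i ∉ I := Finset.mem_compl.1 hi
    simp [Finset.erase_insert hi']

/-- **The step `|x|·e_k ≡ (k+1)·e_{k+1} + k·e_k` modulo the Boolean ideal**, with the Boolean part
of product degree `≤ k + 1`. [cite: LeePrakashDewolfYuen2016, Lemma 4.4 (proof, App. A)] -/
private theorem sum_X_mul_esym (k : ℕ) :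
    ∃ B : MvPolynomial (Fin n) ℝ, InBool n (k + 1) B ∧
      (∑ i : Fin n, X i) * esym n k =
        C ((k : ℝ) + 1) * esym n (k + 1) + C (k : ℝ) * esym n k + B := by
  classical
  refine ⟨∑ I ∈ powersetCard k (univ : Finset (Fin n)),
      ∑ i ∈ I, xProd (I.erase i) * (X i ^ 2 - X i), ?_, ?_⟩
  · refine InBool.sum _ _ fun I hI => InBool.sum _ _ fun i hi => inBool_single i _ ?_
    have hcI : I.card = k := (Finset.mem_powersetCard.1 hI).2
    have hk : 1 ≤ k := hcI ▸ Finset.card_pos.2 ⟨i, hi⟩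
    have h1 : (xProd (I.erase i)).totalDegree ≤ k - 1 := by
      have := totalDegree_xProd_le (n := n) (I.erase i)
      rwa [Finset.card_erase_of_mem hi, hcI] at this
    have h2 := totalDegree_bool_le (n := n) i
    have h3 := totalDegree_mul (xProd (I.erase i)) (X i ^ 2 - X i)
    omega
  · have h1 : ∀ I ∈ powersetCard k (univ : Finset (Fin n)),
        (∑ i : Fin n, X i) * xProd I =
          C (k : ℝ) * xProd I + (∑ i ∈ I, xProd (I.erase i) * (X i ^ 2 - X i)) +
            ∑ i ∈ Iᶜ, xProd (insert i I) := by
      intro I hI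
      have hcI : I.card = k := (Finset.mem_powersetCard.1 hI).2
      rw [Finset.sum_mul, ← Finset.sum_add_sum_compl I]
      congr 1
      · have h2 : ∀ i ∈ I, X i * xProd I = xProd I + xProd (I.erase i) * (X i ^ 2 - X i) := by
          intro i hi
          have hP : xProd I = X i * xProd (I.erase i) := by
            unfold xProd
            rw [Finset.mul_prod_erase I (fun j => (X j : MvPolynomial (Fin n) ℝ)) hi]
          rw [hP]
          ring
        rw [Finset.sum_congr rfl h2, Finset.sum_add_distrib, Finset.sum_const, hcI, nsmul_eq_mul,
          map_natCast C k]
      · refine Finset.sum_congr rfl fun i hi => ?_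
        have hi' : i ∉ I := Finset.mem_compl.1 hi
        unfold xProd
        rw [Finset.prod_insert hi']
    have hL : (∑ i : Fin n, X i) * esym n k =
        C (k : ℝ) * esym n k +
          (∑ I ∈ powersetCard k (univ : Finset (Fin n)),
            ∑ i ∈ I, xProd (I.erase i) * (X i ^ 2 - X i)) +
          ∑ I ∈ powersetCard k (univ : Finset (Fin n)), ∑ i ∈ Iᶜ, xProd (insert i I) := by
      unfold esym
      rw [Finset.mul_sum, Finset.sum_congr rfl h1, Finset.sum_add_distrib, Finset.sum_add_distrib,
        ← Finset.mul_sum]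
    rw [hL, sum_sum_insert k xProd, nsmul_eq_mul]
    unfold esym
    push_cast
    rw [map_add, map_one, map_natCast C k]
    ring

/-- **Lemma 4.4 in the form `A_d(|x|) = ∏_{j<d} (|x| − j) ≡ d!·e_d` modulo the Boolean ideal**, with
products of degree `≤ d`. [cite: LeePrakashDewolfYuen2016, Lemma 4.4] -/
private theorem prod_sub_eq_factorial_mul_esym (d : ℕ) :
    ∃ B : MvPolynomial (Fin n) ℝ, InBool n d B ∧
      (∏ j ∈ range d, ((∑ i : Fin n, X i) - C (j : ℝ))) = C (d.factorial : ℝ) * esym n d + B := by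
  classical
  induction d with
  | zero =>
    refine ⟨0, InBool.zero 0, ?_⟩
    simp [esym, xProd, Finset.powersetCard_zero]
  | succ d ih =>
    obtain ⟨B, hB, hA⟩ := ih
    obtain ⟨B', hB', hstep⟩ := sum_X_mul_esym (n := n) d
    refine ⟨C (d.factorial : ℝ) * B' + ((∑ i : Fin n, X i) - C (d : ℝ)) * B, ?_, ?_⟩
    · refine (hB'.const_mul _).add ?_
      have hdeg : ((∑ i : Fin n, X i) - C (d : ℝ) : MvPolynomial (Fin n) ℝ).totalDegree ≤ 1 :=
        (totalDegree_sub_C_le _ _).trans totalDegree_sumX_le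
      have := hB.mul_left _ hdeg
      rwa [add_comm] at this
    · rw [Finset.prod_range_succ, hA, Nat.factorial_succ]
      push_cast
      simp only [map_mul, map_add, map_one, map_natCast C] at hstep ⊢
      linear_combination (d.factorial : MvPolynomial (Fin n) ℝ) * hstep

/-- `deg (aeval s q) ≤ deg q` for `deg s ≤ 1`. [folklore] -/
private theorem totalDegree_aeval_le (s : MvPolynomial (Fin n) ℝ) (hs : s.totalDegree ≤ 1)
    (q : Polynomial ℝ) : (Polynomial.aeval s q).totalDegree ≤ q.natDegree := by
  rw [Polynomial.aeval_eq_sum_range]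
  refine totalDegree_finsetSum_le fun i hi => ?_
  have hi' : i ≤ q.natDegree := Nat.lt_succ_iff.1 (Finset.mem_range.1 hi)
  refine (totalDegree_smul_le _ _).trans ((totalDegree_pow _ _).trans ?_)
  calc i * s.totalDegree ≤ i * 1 := Nat.mul_le_mul_left _ hs
    _ ≤ q.natDegree := by omega

/-! ### Theorem 4.3 -/

/-- **Lee–Prakash–de Wolf–Yuen 2016, Theorem 4.3 (Grigoriev's knapsack bound is tight).**
For an integer `k` and `k < r < k + 1`, the knapsack system
`Σ_i X_i − r = 0, X_i² − X_i = 0` has a static Positivstellensatz refutation of half-degree `k + 2`,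
i.e. of degree `2k + 4`: `−1 = ((k+2)!/b) Σ_{|I|=k+2} x_I² + Σ_i (x_i² − x_i) g_i/b − (g(|x|)/b)(|x| − r)`
with `b = −r(r−1)⋯(r−k−1) > 0` and `A_{k+2}(X) + b = g(X)(X − r)`.
[cite: LeePrakashDewolfYuen2016, Theorem 4.3] -/
theorem hasSOSRefutation_of_lt (k : ℕ) {r : ℝ} (hr₁ : (k : ℝ) < r) (hr₂ : r < (k : ℝ) + 1) :
    HasSOSRefutation (system n r) (k + 2) := by
  classical
  -- notation
  set D : ℕ := k + 2 with hD
  set s : MvPolynomial (Fin n) ℝ := ∑ i : Fin n, X i with hs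
  -- the constant `b = -A_D(r) > 0`
  set b : ℝ := - ∏ j ∈ range D, (r - (j : ℝ)) with hb
  have hbpos : 0 < b := by
    have hprod : ∏ j ∈ range D, (r - (j : ℝ)) < 0 := by
      rw [hD, Finset.prod_range_succ]
      refine mul_neg_of_pos_of_neg (Finset.prod_pos fun j hj => ?_) ?_
      · have hj' : (j : ℝ) ≤ k := by exact_mod_cast Nat.lt_succ_iff.1 (Finset.mem_range.1 hj)
        linarith
      · push_cast
        linarith
    linarith
  have hbne : b ≠ 0 := hbpos.ne'
  -- the univariate division `A_D + b = (X - r) · G`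
  set fall : Polynomial ℝ := ∏ j ∈ range D, (Polynomial.X - Polynomial.C (j : ℝ)) with hfall
  have heval : fall.eval r = ∏ j ∈ range D, (r - (j : ℝ)) := by
    rw [hfall, Polynomial.eval_prod]
    simp
  set p : Polynomial ℝ := fall + Polynomial.C b with hp
  have hroot : p.IsRoot r := by
    show Polynomial.eval r p = 0
    rw [hp, Polynomial.eval_add, Polynomial.eval_C, heval, hb]
    ring
  set G : Polynomial ℝ := p /ₘ (Polynomial.X - Polynomial.C r) with hG
  have hpG : (Polynomial.X - Polynomial.C r) * G = p :=
    Polynomial.mul_divByMonic_eq_iff_isRoot.2 hroot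
  have hfall_deg : fall.natDegree ≤ D := by
    refine (Polynomial.natDegree_prod_le _ _).trans ?_
    have h1 : ∀ j ∈ range D,
        (Polynomial.X - Polynomial.C (j : ℝ) : Polynomial ℝ).natDegree ≤ 1 := fun j _ =>
      (Polynomial.natDegree_sub_le _ _).trans (by simp)
    exact (Finset.sum_le_sum h1).trans (by simp)
  have hp_deg : p.natDegree ≤ D :=
    (Polynomial.natDegree_add_le _ _).trans (max_le hfall_deg (by simp))
  have hG_deg : G.natDegree ≤ D - 1 := by
    rw [hG, Polynomial.natDegree_divByMonic _ (Polynomial.monic_X_sub_C r),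
      Polynomial.natDegree_X_sub_C]
    omega
  -- transport to `MvPolynomial` along `X ↦ s`
  have hs_deg : s.totalDegree ≤ 1 := totalDegree_sumX_le
  set Gs : MvPolynomial (Fin n) ℝ := Polynomial.aeval s G with hGs
  have hGs_deg : Gs.totalDegree ≤ D - 1 := (totalDegree_aeval_le s hs_deg G).trans hG_deg
  have haeval_fall : Polynomial.aeval s fall = ∏ j ∈ range D, (s - C (j : ℝ)) := by
    rw [hfall, map_prod]
    refine Finset.prod_congr rfl fun j _ => ?_
    rw [map_sub, Polynomial.aeval_X, Polynomial.aeval_C, MvPolynomial.algebraMap_eq]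
  have hmain : (∏ j ∈ range D, (s - C (j : ℝ))) + C b = (s - C r) * Gs := by
    have h := congrArg (Polynomial.aeval s) hpG
    rw [map_mul, map_sub, Polynomial.aeval_X, Polynomial.aeval_C, MvPolynomial.algebraMap_eq, hp,
      map_add, Polynomial.aeval_C, MvPolynomial.algebraMap_eq, haeval_fall] at h
    rw [hGs]
    exact h.symm
  -- Lemma 4.4: `A_D(s) = D!·e_D + B₁`, and `Σ x_I² = e_D + S₂` with `S₂` Boolean
  obtain ⟨B₁, hB₁, hA⟩ := prod_sub_eq_factorial_mul_esym (n := n) D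
  set S₂ : MvPolynomial (Fin n) ℝ :=
    ∑ I ∈ powersetCard D (univ : Finset (Fin n)), (xProd I * xProd I - xProd I) with hS₂
  have hB₂ : InBool n (2 * D) S₂ :=
    InBool.sum _ _ fun I hI => by
      have hcI : I.card = D := (Finset.mem_powersetCard.1 hI).2
      have := xProd_sq_sub_inBool I
      rwa [hcI] at this
  have hsq : ∑ I ∈ powersetCard D (univ : Finset (Fin n)), xProd I * xProd I = esym n D + S₂ := by
    rw [hS₂, Finset.sum_sub_distrib, esym]
    ring
  -- the Boolean multipliers of the certificate
  obtain ⟨h, hh, hdeg⟩ : InBool n (2 * D) (C (D.factorial : ℝ) * S₂ - B₁) :=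
    (hB₂.const_mul _).sub (hB₁.mono (by omega))
  -- the squares, indexed by `Fin m`
  set T : Finset (Finset (Fin n)) := powersetCard D (univ : Finset (Fin n)) with hT
  set c : ℝ := Real.sqrt ((D.factorial : ℝ) / b) with hc
  have hcc : c * c = (D.factorial : ℝ) / b := Real.mul_self_sqrt (by positivity)
  let e : {I // I ∈ T} ≃ Fin T.card := T.equivFin
  let q : Fin T.card → MvPolynomial (Fin n) ℝ := fun l => C c * xProd (e.symm l).1
  let g : Option (Fin n) → MvPolynomial (Fin n) ℝ := fun o =>
    Option.casesOn o (C (-b⁻¹) * Gs) fun i => C (-b⁻¹) * h i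
  refine ⟨T.card, q, g, fun l => ?_, fun o => ?_, ?_⟩
  · -- degrees of the squares
    have h1 := totalDegree_xProd_le (n := n) (e.symm l).1
    have h2 : ((e.symm l).1).card = D := (Finset.mem_powersetCard.1 (e.symm l).2).2
    refine (totalDegree_mul _ _).trans ?_
    rw [totalDegree_C]
    omega
  · -- degrees of the products
    cases o with
    | none =>
      show (C (-b⁻¹) * Gs * ((∑ i : Fin n, X i) - C r)).totalDegree ≤ 2 * (k + 2)
      refine (totalDegree_mul _ _).trans ?_
      have h1 : (C (-b⁻¹) * Gs).totalDegree ≤ D - 1 :=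
        (totalDegree_mul _ _).trans (by rw [totalDegree_C, zero_add]; exact hGs_deg)
      have h2 : ((∑ i : Fin n, X i) - C r : MvPolynomial (Fin n) ℝ).totalDegree ≤ 1 :=
        (totalDegree_sub_C_le _ _).trans totalDegree_sumX_le
      omega
    | some i =>
      show (C (-b⁻¹) * h i * (X i ^ 2 - X i)).totalDegree ≤ 2 * (k + 2)
      rw [mul_assoc]
      refine (totalDegree_mul _ _).trans ?_
      rw [totalDegree_C, zero_add]
      exact hdeg i
  · -- the identity
    have hsumq : ∑ l, q l * q l = C (c * c) * ∑ I ∈ T, xProd I * xProd I := by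
      rw [Finset.mul_sum]
      have hre : ∀ g' : Finset (Fin n) → MvPolynomial (Fin n) ℝ,
          ∑ l, g' (e.symm l).1 = ∑ I ∈ T, g' I := by
        intro g'
        rw [Equiv.sum_comp e.symm (fun x : {I // I ∈ T} => g' x.1), Finset.sum_coe_sort]
      rw [← hre (fun I => C (c * c) * (xProd I * xProd I))]
      refine Finset.sum_congr rfl fun l _ => ?_
      show C c * xProd (e.symm l).1 * (C c * xProd (e.symm l).1) = _
      rw [map_mul]
      ring
    have hsumg : ∑ o, g o * system n r o =
        C (-b⁻¹) * Gs * (s - C r) + C (-b⁻¹) * (C (D.factorial : ℝ) * S₂ - B₁) := by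
      rw [Fintype.sum_option, ← hh, Finset.mul_sum]
      have hg0 : g none * system n r none = C (-b⁻¹) * Gs * (s - C r) := rfl
      rw [hg0]
      congr 1
      refine Finset.sum_congr rfl fun i _ => ?_
      show C (-b⁻¹) * h i * (X i ^ 2 - X i) = C (-b⁻¹) * (h i * (X i ^ 2 - X i))
      rw [mul_assoc]
    rw [hsumq, hsumg, hT, hsq, hcc]
    have hbb : (C b⁻¹ : MvPolynomial (Fin n) ℝ) * C b = 1 := by
      rw [← map_mul, inv_mul_cancel₀ hbne, map_one]
    have hA' : (s - C r) * Gs = C (D.factorial : ℝ) * esym n D + B₁ + C b := by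
      rw [← hmain, hA]
    rw [map_neg, show ((D.factorial : ℝ) / b) = (D.factorial : ℝ) * b⁻¹ from div_eq_mul_inv _ _,
      map_mul]
    linear_combination (-(C b⁻¹ : MvPolynomial (Fin n) ℝ)) * hA' - hbb

/-- **The exact static-SOS threshold of the knapsack** (Grigoriev 2001, Theorem (i) + Lee–Prakash–
de Wolf–Yuen 2016, Theorem 4.3): for an integer `k` with `2k + 2 ≤ n` and `k < r < k + 1`, the
system `Σ X_i = r, X_i² = X_i` has a static Positivstellensatz refutation of half-degree `d` iff
`d ≥ k + 2` (refutation degree exactly `2k + 4`).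
[cite: LeePrakashDewolfYuen2016, Theorems 4.2–4.3] -/
theorem hasSOSRefutation_iff {k : ℕ} {r : ℝ} (hkn : 2 * k + 2 ≤ n) (hr₁ : (k : ℝ) < r)
    (hr₂ : r < (k : ℝ) + 1) (d : ℕ) : HasSOSRefutation (system n r) d ↔ k + 2 ≤ d := by
  constructor
  · intro h
    by_contra hlt
    have hd : d ≤ k + 1 := by omega
    have hk1 := not_hasSOSRefutation_succ (n := n) hkn hr₁
      (by have : (2 * k + 2 : ℝ) ≤ n := by exact_mod_cast hkn
          linarith)
    exact hk1 (h.mono hd)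
  · intro hd
    exact (hasSOSRefutation_of_lt k hr₁ hr₂).mono hd

/-! ### The pseudo-expectation form: Grigoriev's functional fails at degree `k + 2` -/

/-- **Tightness in pseudo-expectation form.** For `k < r < k + 1` and `|I| = k + 2 ≤ n`, Grigoriev's
functional `B` is negative on the square of the monomial `x_I`:
`B(x_I · x_I) = B(x_I) = B_{k+2} = r(r−1)⋯(r−k−1)/(n(n−1)⋯(n−k−1)) < 0` (one negative factor
`r − k − 1`).  So `B` — positive on squares of degree `≤ k + 1` by Grigoriev's Lemma 1.4 — is not a
pseudo-expectation of degree `k + 2`; the witness polynomial is `h = x_I`.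
[cite: Grigoriev2001, §1 (definition of `B`, PDF p. 8) and Theorem (i)]
[cite: LeePrakashDewolfYuen2016, Theorem 4.3] -/
theorem functional_xProd_neg (k : ℕ) {r : ℝ} (hr₁ : (k : ℝ) < r) (hr₂ : r < (k : ℝ) + 1)
    (I : Finset (Fin n)) (hI : I.card = k + 2) :
    functional n r ((∏ i ∈ I, X i) * ∏ i ∈ I, X i) < 0 := by
  classical
  -- `x_I · x_I` is the monomial `X^(2·1_I)`, whose support is `I`
  have hmono : ((∏ i ∈ I, X i) * ∏ i ∈ I, X i : MvPolynomial (Fin n) ℝ) =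
      monomial (∑ i ∈ I, Finsupp.single i 2) 1 := by
    rw [← Finset.prod_mul_distrib, monomial_sum_index, map_one, one_mul]
    refine Finset.prod_congr rfl fun i _ => ?_
    rw [← sq, X_pow_eq_monomial]
  have hsupp : (∑ i ∈ I, Finsupp.single i 2 : Fin n →₀ ℕ).support = I := by
    ext j
    rw [Finsupp.mem_support_iff, Finsupp.finsetSum_apply]
    simp only [Finsupp.single_apply, Finset.sum_ite_eq']
    by_cases hj : j ∈ I
    · simp [hj]
    · simp [hj]
  have hkn : k + 2 ≤ n := by
    have := Finset.card_le_univ I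
    rw [Fintype.card_fin, hI] at this
    exact this
  rw [hmono, functional_monomial, one_mul, hsupp, hI, knapsackMoment, Finset.prod_range_succ]
  have hkn' : ((k : ℝ) + 1) < n := by
    have : ((k + 2 : ℕ) : ℝ) ≤ n := by exact_mod_cast hkn
    push_cast at this
    linarith
  refine mul_neg_of_pos_of_neg (Finset.prod_pos fun j hj => ?_) ?_
  · have hj : (j : ℝ) ≤ k := by exact_mod_cast Nat.lt_succ_iff.1 (Finset.mem_range.1 hj)
    exact div_pos (by linarith) (by linarith)
  · push_cast
    exact div_neg_of_neg_of_pos (by linarith) (by linarith)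

end Knapsack

end Literature.Computability.Complexity
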